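import Literature.Claims.NS.Xu2024
import Literature.Analysis.FluidPDE.BoundedLerayHopfClay
import Literature.Analysis.FluidPDE.PressureNormalisationLp
import Literature.Analysis.FluidPDE.TaoClassGlobal
import HarnessLib

/-!
# Solo salvage for claim C10 `Xu2024` — part 1: Tao-class slabs in the setting of the claim's Theorem 1.1

Cell `ns-claims` (D-0090), salvage seat `ns-claims-salvage-p4` g3, solo lane (no statement item). Toolkit for
`SoloSalvageXu2024.lean`, which discharges the skeleton's continuation step
`Literature.Claims.NS.Xu2024.Step_15` (Leray's structure theorem in Kato's formulation). Contents:

* `memLp_of_bound_of_memLp` — `L^a ∩ L^∞ ⊂ L^b`, `0 < a ≤ b < ∞`, with the explicit bound;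
* `exists_eLpNorm_pressure_le_of_isTaoSolutionOn`, `memLp_pressure_of_isTaoSolutionOn` — **the pressure of a
  Tao-class solution lies in every `Lˢ(ℝ³)`, `1 < s < ∞`** (`s ≥ 2`: bounded + `L²`; `s < 2`: Tao's Lemma 4.1 (i)
  in `Lˢ`, `PressureNormalisationLp.exists_pressure_sub_const_memLp`, the additive constant being `0` because the
  Tao-class pressure is already in `L²`; the slice `t = 0` by Fatou);
* `isLocalStrongSolution_of_isTaoSolutionOn` — a Tao-class solution on `[0,T'']` is, on `[0,T]`, `T < T''`, a
  solution in the setting of the claim's Theorem 1.1 (`Literature.Claims.NS.Xu2024.IsLocalStrongSolution 3`);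
* `glue_slab`, `isLocalStrongSolution_congr`, `glue_unbounded` — gluing the Tao-class solutions on the slabs
  `[0,S]`, `S < T*`, by Prodi–Serrin uniqueness (`IsTaoSolutionOn.eq_of_isTaoSolutionOn`) and pressure pinning
  (`IsTaoSolutionOn.pressure_eq`); unboundedness of the glued velocity below a singular time of the Kato
  solution (`IsTaoSolutionOn.ae_eq_of_kato`, Lemarié-Rieusset 2016 Thm. 15.1 (C)).

WHAT THIS IS NOT: not a claim about NS regularity or blow-up; not a claim about any author beyond the typed locator.

## References
* T. Tao, Anal. PDE 6 (2013) = arXiv:1108.1165, Lemma 4.1 (i). [`Tao2011`]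
* P. G. Lemarié-Rieusset, *The Navier–Stokes Problem in the 21st Century*, CRC 2016, Prop. 12.3, Thm. 15.1.
-/

set_option linter.dupNamespace false

noncomputable section

open MeasureTheory Set Filter Topology Function
open scoped ENNReal NNReal ContDiff

namespace Summit.NavierStokesRegularity.NavierStokesRegularity.Theorems.Xu2024

open Literature.Analysis.FluidPDE

/-! ## Two measure-theoretic helpers: `L^a ∩ L^∞ ⊂ L^b` -/

/-- Pointwise-bounded functions: `∫ ‖f‖^b ≤ B^{b−a} ∫ ‖f‖^a` for `0 < a ≤ b` and `‖f‖ ≤ B`. [folklore] -/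
theorem lintegral_rpow_le_of_bound {α : Type*} [MeasurableSpace α] {μ : Measure α} {E : Type*}
    [NormedAddCommGroup E] {f : α → E} {B : ℝ} (hB : ∀ x, ‖f x‖ ≤ B) {a b : ℝ} (ha : 0 < a)
    (hab : a ≤ b) :
    ∫⁻ x, ‖f x‖ₑ ^ b ∂μ ≤ ENNReal.ofReal B ^ (b - a) * ∫⁻ x, ‖f x‖ₑ ^ a ∂μ := by
  rw [← lintegral_const_mul' _ _ (ENNReal.rpow_ne_top_of_nonneg (by linarith) ENNReal.ofReal_ne_top)]
  refine lintegral_mono fun x => ?_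
  have hsplit : ‖f x‖ₑ ^ b = ‖f x‖ₑ ^ (b - a) * ‖f x‖ₑ ^ a := by
    rw [← ENNReal.rpow_add_of_nonneg (x := ‖f x‖ₑ) (b - a) a (sub_nonneg.2 hab) ha.le, sub_add_cancel]
  rw [hsplit]
  gcongr
  rw [← ofReal_norm]
  exact ENNReal.ofReal_le_ofReal (hB x)

/-- `L^a ∩ L^∞ ⊂ L^b` (`0 < a ≤ b < ∞`): a pointwise-bounded `L^a` function is in `L^b`, with
`‖f‖_b ≤ (B^{b−a} ‖f‖_a^a)^{1/b}`. [folklore] -/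
theorem memLp_of_bound_of_memLp {α : Type*} [MeasurableSpace α] {μ : Measure α} {E : Type*}
    [NormedAddCommGroup E] {f : α → E} {B : ℝ} (hB : ∀ x, ‖f x‖ ≤ B) {a b : ℝ≥0∞} (ha : a ≠ 0)
    (hab : a ≤ b) (hb : b ≠ ⊤) (hf : MemLp f a μ) :
    MemLp f b μ ∧ eLpNorm f b μ ≤
      (ENNReal.ofReal B ^ (b.toReal - a.toReal) * ∫⁻ x, ‖f x‖ₑ ^ a.toReal ∂μ) ^ (1 / b.toReal) := by
  have hatop : a ≠ ⊤ := ne_top_of_le_ne_top hb hab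
  have hb0 : b ≠ 0 := by rintro rfl; exact ha (le_antisymm hab bot_le)
  have ha' : 0 < a.toReal := ENNReal.toReal_pos ha hatop
  have hb' : 0 < b.toReal := ENNReal.toReal_pos hb0 hb
  have hab' : a.toReal ≤ b.toReal := ENNReal.toReal_mono hb hab
  have hbound : eLpNorm f b μ ≤
      (ENNReal.ofReal B ^ (b.toReal - a.toReal) * ∫⁻ x, ‖f x‖ₑ ^ a.toReal ∂μ) ^ (1 / b.toReal) := by
    rw [eLpNorm_eq_lintegral_rpow_enorm_toReal hb0 hb]
    gcongr
    exact lintegral_rpow_le_of_bound hB ha' hab'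
  have hfin : (ENNReal.ofReal B ^ (b.toReal - a.toReal) * ∫⁻ x, ‖f x‖ₑ ^ a.toReal ∂μ) ^ (1 / b.toReal)
      < ⊤ := by
    refine ENNReal.rpow_lt_top_of_nonneg (by positivity) (ENNReal.mul_ne_top ?_ ?_)
    · exact ENNReal.rpow_ne_top_of_nonneg (by linarith) ENNReal.ofReal_ne_top
    · exact (lintegral_rpow_enorm_lt_top_of_eLpNorm_lt_top ha hatop hf.eLpNorm_lt_top).ne
  exact ⟨⟨hf.aestronglyMeasurable, hbound.trans_lt hfin⟩, hbound⟩

/-- A constant is in `L^q(ℝ³)`, `0 < q < ∞`, only if it vanishes (`ℝ³` has infinite volume). [folklore] -/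
theorem const_eq_zero_of_memLp {q : ℝ≥0∞} (hq0 : q ≠ 0) (hq : q ≠ ⊤) {C : ℝ}
    (h : MemLp (fun _ : (EuclideanSpace ℝ (Fin 3)) => C) q volume) : C = 0 := by
  rcases (memLp_const_iff hq0 hq).1 h with h | h
  · exact h
  · exact absurd h (by simp)


/-! ## The pressure of a Tao-class solution is in every `Lˢ`, `1 < s < ∞` -/

section TaoPressure

variable {T ν : ℝ} {u₀ : (EuclideanSpace ℝ (Fin 3)) → (EuclideanSpace ℝ (Fin 3))}
  {u : ℝ → (EuclideanSpace ℝ (Fin 3)) → (EuclideanSpace ℝ (Fin 3))} {p : ℝ → (EuclideanSpace ℝ (Fin 3)) → ℝ}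

/-- The pressure slices of a Tao-class solution are in `L²` (the `n = 0` Sobolev bound). [folklore] -/
theorem memLp_two_pressure_of_isTaoSolutionOn (h : IsTaoSolutionOn T ν u₀ u p) {t : ℝ}
    (ht : t ∈ Icc 0 T) : MemLp (p t) 2 volume := by
  obtain ⟨C, hC⟩ := h.sobolev_p 0
  refine ⟨(h.classical.contDiff_pressure ht).continuous.aestronglyMeasurable,
    eLpNorm_two_lt_top_of_lintegral_enorm_sq_lt_top ?_⟩
  refine lt_of_le_of_lt (le_of_eq (lintegral_congr fun x => ?_)) ((hC t ht).trans_lt ENNReal.coe_lt_top)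
  rw [← ofReal_norm, ← ofReal_norm, norm_iteratedFDeriv_zero]

/-- **Uniform `L^r` bounds of a Tao-class velocity**, `2 ≤ r < ∞`: the slices are bounded by `B`
(`exists_bound_velocity`) and have energy `≤ ‖u₀‖²₂` (Leray–Hopf), so `‖u(t)‖_r` is bounded on
`[0,T]` by a constant. [folklore] -/
theorem exists_eLpNorm_velocity_le_of_isTaoSolutionOn (h : IsTaoSolutionOn T ν u₀ u p) (hT : 0 < T)
    (hν : 0 ≤ ν) {r : ℝ≥0∞} (h2r : 2 ≤ r) (hr : r ≠ ⊤) :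
    ∃ M : ℝ≥0, ∀ t ∈ Icc 0 T, MemLp (u t) r volume ∧ eLpNorm (u t) r volume ≤ M := by
  obtain ⟨B, -, hB⟩ := h.exists_bound_velocity
  set K : ℝ≥0∞ := (ENNReal.ofReal B ^ (r.toReal - (2 : ℝ≥0∞).toReal) *
    ENNReal.ofReal (2 * VectorCalculus.kineticEnergy u₀)) ^ (1 / r.toReal) with hK
  have hKtop : K < ⊤ := by
    have hr2' : (2 : ℝ≥0∞).toReal ≤ r.toReal := ENNReal.toReal_mono hr h2r
    refine ENNReal.rpow_lt_top_of_nonneg (by positivity) (ENNReal.mul_ne_top ?_ ENNReal.ofReal_ne_top)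
    exact ENNReal.rpow_ne_top_of_nonneg (by linarith) ENNReal.ofReal_ne_top
  refine ⟨K.toNNReal, fun t ht => ?_⟩
  have h2 : MemLp (u t) 2 volume := h.continuousL2.1 t ht
  obtain ⟨hmem, hle⟩ := memLp_of_bound_of_memLp (hB t ht) two_ne_zero h2r hr h2
  refine ⟨hmem, ?_⟩
  rw [ENNReal.coe_toNNReal hKtop.ne, hK]
  refine hle.trans ?_
  have hE : ∫⁻ x, ‖u t x‖ₑ ^ (2 : ℝ≥0∞).toReal ≤ ENNReal.ofReal (2 * VectorCalculus.kineticEnergy u₀) := by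
    have := h.lintegral_enorm_sq_le hT hν ht
    simpa [ENNReal.toReal_ofNat] using this
  gcongr

/-- **Tao's pressure normalisation in `Lˢ` for Tao-class solutions, interior times**: for `1 < s < ∞`
and `0 < t < T` the pressure slice `p(t)` of a Tao-class solution on `[0,T]` lies in `Lˢ(ℝ³)`, with
`‖p(t)‖ₛ` bounded uniformly in `t`. For `s ≥ 2` this is `L² ∩ L^∞ ⊂ Lˢ` (`exists_bound_pressure`);
for `s < 2` it is Lemma 4.1 (i) of Tao in `Lˢ` (`PressureNormalisationLp.exists_pressure_sub_const_memLp`: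
`p(t) − C(t)` is a Calderón–Zygmund pressure in `Lˢ`), where `C(t) = 0` because `p(t) − C(t)` is also
bounded, hence in `L²`, as is `p(t)`. [cite: Tao2011, Lemma 4.1 (i)] -/
theorem exists_eLpNorm_pressure_le_of_isTaoSolutionOn (h : IsTaoSolutionOn T ν u₀ u p) (hν : 0 < ν)
    (hT : 0 < T) {s : ℝ} (hs : 1 < s) :
    ∃ K : ℝ≥0∞, K < ⊤ ∧ ∀ t ∈ Ioo 0 T,
      MemLp (p t) (ENNReal.ofReal s) volume ∧ eLpNorm (p t) (ENNReal.ofReal s) volume ≤ K := by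
  have hs0 : (ENNReal.ofReal s) ≠ 0 := (ENNReal.ofReal_pos.2 (by linarith)).ne'
  have hstop : ENNReal.ofReal s ≠ ⊤ := ENNReal.ofReal_ne_top
  obtain ⟨Pb, -, hPb⟩ := h.exists_bound_pressure
  obtain ⟨C₀, hC₀⟩ := h.sobolev_p 0
  have hL2int : ∀ t ∈ Icc 0 T, ∫⁻ x, ‖p t x‖ₑ ^ (2 : ℝ≥0∞).toReal ≤ C₀ := by
    intro t ht
    refine le_trans (le_of_eq (lintegral_congr fun x => ?_)) (hC₀ t ht)
    rw [ENNReal.toReal_ofNat, ENNReal.rpow_ofNat, ← ofReal_norm, ← ofReal_norm, norm_iteratedFDeriv_zero]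
  rcases le_or_gt 2 s with h2s | hs2
  · -- `s ≥ 2`: bounded + `L²`
    have h2s' : (2 : ℝ≥0∞) ≤ ENNReal.ofReal s := by
      rw [← ENNReal.ofReal_ofNat 2]; exact ENNReal.ofReal_le_ofReal h2s
    set K : ℝ≥0∞ := (ENNReal.ofReal Pb ^ ((ENNReal.ofReal s).toReal - (2 : ℝ≥0∞).toReal) * C₀) ^
      (1 / (ENNReal.ofReal s).toReal) with hK
    have hKtop : K < ⊤ := by
      have : (2 : ℝ≥0∞).toReal ≤ (ENNReal.ofReal s).toReal := ENNReal.toReal_mono hstop h2s'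
      refine ENNReal.rpow_lt_top_of_nonneg (by positivity) (ENNReal.mul_ne_top ?_ ENNReal.coe_ne_top)
      exact ENNReal.rpow_ne_top_of_nonneg (by linarith) ENNReal.ofReal_ne_top
    refine ⟨K, hKtop, fun t ht => ?_⟩
    have htc : t ∈ Icc 0 T := ⟨ht.1.le, ht.2.le⟩
    obtain ⟨hmem, hle⟩ := memLp_of_bound_of_memLp (hPb t htc) two_ne_zero h2s' hstop
      (memLp_two_pressure_of_isTaoSolutionOn h htc)
    refine ⟨hmem, hle.trans ?_⟩
    rw [hK]
    gcongr
    exact hL2int t htc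
  · -- `1 < s < 2`: Tao's normalisation; the constant vanishes
    have hs2' : ENNReal.ofReal s ≤ 2 := by
      rw [← ENNReal.ofReal_ofNat 2]; exact ENNReal.ofReal_le_ofReal hs2.le
    have hr2 : (2 : ℝ≥0∞) ≤ ENNReal.ofReal s * 2 := by
      have h1 : (1 : ℝ≥0∞) ≤ ENNReal.ofReal s := by
        rw [← ENNReal.ofReal_one]; exact ENNReal.ofReal_le_ofReal hs.le
      calc (2 : ℝ≥0∞) = 1 * 2 := (one_mul _).symm
        _ ≤ ENNReal.ofReal s * 2 := by gcongr
    have hrtop : ENNReal.ofReal s * 2 ≠ ⊤ := ENNReal.mul_ne_top hstop ENNReal.ofNat_ne_top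
    obtain ⟨M, hM⟩ := exists_eLpNorm_velocity_le_of_isTaoSolutionOn h hT hν.le hr2 hrtop
    obtain ⟨Cq, hCq⟩ :=
      PressureNormalisationLp.exists_pressure_sub_const_memLp (ν := ν) (u := u) (p := p) hs
    have hopen : IsClassicalNSSolutionOn (Ioo 0 T) ν 0 u p :=
      h.classical.mono Ioo_subset_Icc_self (isOpen_Ioo.uniqueDiffOn)
    have hkey := hCq 0 T hν.le hopen M (fun t ht => (hM t ⟨ht.1.le, ht.2.le⟩).1)
      (fun t ht => (hM t ⟨ht.1.le, ht.2.le⟩).2)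
    refine ⟨Cq * (M : ℝ≥0∞) ^ 2, ENNReal.mul_lt_top ENNReal.coe_lt_top (ENNReal.pow_lt_top ENNReal.coe_lt_top),
      fun t ht => ?_⟩
    have htc : t ∈ Icc 0 T := ⟨ht.1.le, ht.2.le⟩
    obtain ⟨C, hC1, hC2, -⟩ := hkey t ht
    -- `p t - C` is bounded, hence in `L²`; so is `p t`; hence `C = 0`
    have hbdC : ∀ x, ‖p t x - C‖ ≤ Pb + ‖C‖ := fun x =>
      (norm_sub_le _ _).trans (by gcongr; exact hPb t htc x)
    have hC2' : MemLp (fun x => p t x - C) 2 volume :=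
      (memLp_of_bound_of_memLp hbdC hs0 hs2' ENNReal.ofNat_ne_top hC1).1
    have hp2 : MemLp (p t) 2 volume := memLp_two_pressure_of_isTaoSolutionOn h htc
    have hconst : MemLp (fun _ : (EuclideanSpace ℝ (Fin 3)) => C) 2 volume := by
      have h' := hp2.sub hC2'
      refine h'.ae_eq (Filter.Eventually.of_forall fun x => ?_)
      simp only [Pi.sub_apply, sub_sub_cancel]
    have hC0 : C = 0 := const_eq_zero_of_memLp two_ne_zero ENNReal.ofNat_ne_top hconst
    subst hC0
    simp only [sub_zero] at hC1 hC2
    exact ⟨hC1, hC2.trans (by gcongr; exact (hM t htc).2)⟩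

/-- **Every pressure slice of a Tao-class solution is in `Lˢ`, `1 < s < ∞`, including `t = 0`**: interior
times by `exists_eLpNorm_pressure_le_of_isTaoSolutionOn`; the initial slice by Fatou
(`Lp.eLpNorm_lim_le_liminf_eLpNorm`) along `tₙ = T/(n+2) → 0⁺`, the pressure being jointly continuous on
`[0,T] × ℝ³` and `‖p(tₙ)‖ₛ` uniformly bounded. [cite: Tao2011, Lemma 4.1 (i)] -/
theorem memLp_pressure_of_isTaoSolutionOn (h : IsTaoSolutionOn T ν u₀ u p) (hν : 0 < ν) (hT : 0 < T)
    {t : ℝ} (ht : t ∈ Ico 0 T) {s : ℝ} (hs : 1 < s) : MemLp (p t) (ENNReal.ofReal s) volume := by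
  obtain ⟨K, hKtop, hK⟩ := exists_eLpNorm_pressure_le_of_isTaoSolutionOn h hν hT hs
  rcases ht.1.eq_or_lt with h0 | hpos
  · -- `t = 0`: Fatou
    subst h0
    set tn : ℕ → ℝ := fun n => T / ((n : ℝ) + 2) with htn_def
    have htn : ∀ n, tn n ∈ Ioo 0 T := fun n => by
      refine ⟨by positivity, ?_⟩
      rw [htn_def, div_lt_iff₀ (by positivity)]
      nlinarith
    have hlim0 : Tendsto tn atTop (𝓝 0) := by
      have h1 : Tendsto (fun n : ℕ => (n : ℝ) + 2) atTop atTop :=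
        tendsto_natCast_atTop_atTop.atTop_add tendsto_const_nhds
      exact tendsto_const_nhds.div_atTop h1
    have hcont : ContinuousOn (uncurry p) (Icc 0 T ×ˢ univ) := h.classical.smooth_pressure.continuousOn
    have hptw : ∀ x, Tendsto (fun n => p (tn n) x) atTop (𝓝 (p 0 x)) := by
      intro x
      have hx : ((0 : ℝ), x) ∈ Icc 0 T ×ˢ (univ : Set (EuclideanSpace ℝ (Fin 3))) := ⟨⟨le_rfl, hT.le⟩, mem_univ _⟩
      have hc := (hcont (0, x) hx).tendsto
      have hseq : Tendsto (fun n => ((tn n, x) : ℝ × (EuclideanSpace ℝ (Fin 3)))) atTop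
          (𝓝[Icc 0 T ×ˢ univ] ((0 : ℝ), x)) := by
        refine tendsto_nhdsWithin_iff.2 ⟨hlim0.prodMk_nhds tendsto_const_nhds,
          Eventually.of_forall fun n => ⟨⟨(htn n).1.le, (htn n).2.le⟩, mem_univ _⟩⟩
      exact hc.comp hseq
    have hmeas : ∀ n, AEStronglyMeasurable (p (tn n)) volume := fun n =>
      (h.classical.contDiff_pressure ⟨(htn n).1.le, (htn n).2.le⟩).continuous.aestronglyMeasurable
    have hfatou := Lp.eLpNorm_lim_le_liminf_eLpNorm (p := ENNReal.ofReal s) hmeas (p 0)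
      (Eventually.of_forall hptw)
    have hlim : liminf (fun n => eLpNorm (p (tn n)) (ENNReal.ofReal s) volume) atTop ≤ K :=
      liminf_le_of_frequently_le' (Eventually.of_forall fun n => (hK (tn n) (htn n)).2).frequently
    exact ⟨(h.classical.contDiff_pressure ⟨le_rfl, hT.le⟩).continuous.aestronglyMeasurable,
      (hfatou.trans hlim).trans_lt hKtop⟩
  · exact (hK t ⟨hpos, ht.2⟩).1

/-- **A Tao-class solution on `[0,T'']` is, on every shorter closed slab `[0,T]`, a solution in the setting
of the claim's Theorem 1.1** (`IsLocalStrongSolution 3 ν T u₀ u p`): classical, bounded, datum in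
`L² ∩ L^∞`, pressure slices in every `Lˢ`, `s > 1`. [cite: LemarieRieusset2016, Prop. 12.3] -/
theorem isLocalStrongSolution_of_isTaoSolutionOn {T'' : ℝ} (h : IsTaoSolutionOn T'' ν u₀ u p)
    (hν : 0 < ν) {T : ℝ} (hT : 0 < T) (hTT : T < T'') (hu2 : MemLp u₀ 2 volume)
    (hu_top : MemLp u₀ ⊤ volume) :
    Literature.Claims.NS.Xu2024.IsLocalStrongSolution 3 ν T u₀ u p where
  three_le := le_rfl
  nu_pos := hν
  T_pos := hT
  ns := h.classical.mono (Icc_subset_Icc_right hTT.le) (uniqueDiffOn_Icc hT)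
  initial := h.initial
  data_L2 := hu2
  data_Linf := hu_top
  bounded := by
    obtain ⟨B, -, hB⟩ := h.exists_bound_velocity
    exact ⟨B, fun t ht x => hB t ⟨ht.1, ht.2.trans hTT.le⟩ x⟩
  pressure_Lp t ht s hs :=
    memLp_pressure_of_isTaoSolutionOn h hν (hT.trans hTT) ⟨ht.1, ht.2.trans_lt hTT⟩ hs

end TaoPressure

/-! ## Gluing the Tao-class solutions below Kato's maximal time -/

section Glue

variable {ν Ts : ℝ} {u₀ : (EuclideanSpace ℝ (Fin 3)) → (EuclideanSpace ℝ (Fin 3))}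
  {U : ℝ → ℝ → (EuclideanSpace ℝ (Fin 3)) → (EuclideanSpace ℝ (Fin 3))} {P : ℝ → ℝ → (EuclideanSpace ℝ (Fin 3)) → ℝ}

/-- **Consistency of the Tao-class family** `(U S, P S)` on `[0,S]`, `0 < S < T*`: on `[0,T]`, `T < T*`,
the glued fields `t ↦ U((t+T*)/2)(t)`, `t ↦ P((t+T*)/2)(t)` coincide with the single Tao-class solution
on `[0,(T+T*)/2]` — velocities by Prodi–Serrin uniqueness in Tao's class (`eq_of_isTaoSolutionOn`),
pressures because the `L²` pressure is determined by the velocity (`pressure_eq`).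
[cite: RobinsonRodrigoSadowski2016, Thm. 8.19] -/
theorem glue_slab (hUP : ∀ S ∈ Ioo 0 Ts, IsTaoSolutionOn S ν u₀ (U S) (P S)) (hν : 0 < ν) {T : ℝ}
    (hT : T ∈ Ioo 0 Ts) :
    ∀ t ∈ Icc 0 T, U ((t + Ts) / 2) t = U ((T + Ts) / 2) t ∧ P ((t + Ts) / 2) t = P ((T + Ts) / 2) t := by
  intro t ht
  have hτ : (t + Ts) / 2 ∈ Ioo 0 Ts :=
    ⟨by linarith [ht.1, hT.1, hT.2], by linarith [ht.2, hT.2]⟩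
  have hT'' : (T + Ts) / 2 ∈ Ioo 0 Ts := ⟨by linarith [hT.1, hT.2], by linarith [hT.2]⟩
  have htτ : t < (t + Ts) / 2 := by linarith [ht.2, hT.2]
  have hτT : (t + Ts) / 2 ≤ (T + Ts) / 2 := by linarith [ht.2]
  have h₁ := hUP _ hτ
  have h₂ := hUP _ hT''
  have hvel : ∀ s ∈ Ico 0 ((t + Ts) / 2), U ((t + Ts) / 2) s = U ((T + Ts) / 2) s := by
    intro s hs
    exact h₁.eq_of_isTaoSolutionOn h₂ hν hτ.1 hT''.1 s ⟨hs.1, lt_min hs.2 (hs.2.trans_le hτT)⟩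
  refine ⟨hvel t ⟨ht.1, htτ⟩, ?_⟩
  -- pressures on `[0, m]`, `m = (t + τ)/2`
  set m : ℝ := (t + (t + Ts) / 2) / 2 with hm
  have hm0 : 0 < m := by rw [hm]; linarith [ht.1, hτ.1]
  have hmτ : m < (t + Ts) / 2 := by rw [hm]; linarith
  have htm : t ≤ m := by rw [hm]; linarith
  exact h₁.pressure_eq h₂ hm0 hmτ.le (hmτ.le.trans hτT)
    (fun s hs => hvel s ⟨hs.1, hs.2.trans_lt hmτ⟩) t ⟨ht.1, htm⟩

/-- Transport of the Theorem-1.1 setting along equality of slices on `[0,T]`. [folklore] -/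
theorem isLocalStrongSolution_congr {T : ℝ} {u v : ℝ → (EuclideanSpace ℝ (Fin 3)) → (EuclideanSpace ℝ (Fin 3))}
    {p q : ℝ → (EuclideanSpace ℝ (Fin 3)) → ℝ}
    (h : Literature.Claims.NS.Xu2024.IsLocalStrongSolution 3 ν T u₀ u p)
    (huv : ∀ t ∈ Icc 0 T, v t = u t ∧ q t = p t) :
    Literature.Claims.NS.Xu2024.IsLocalStrongSolution 3 ν T u₀ v q where
  three_le := h.three_le
  nu_pos := h.nu_pos
  T_pos := h.T_pos
  ns := h.ns.congr_slices (fun t ht => (huv t ht).1) (fun t ht => (huv t ht).2)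
  initial := by rw [(huv 0 ⟨le_rfl, h.T_pos.le⟩).1, h.initial]
  data_L2 := h.data_L2
  data_Linf := h.data_Linf
  bounded := by
    obtain ⟨M, hM⟩ := h.bounded
    exact ⟨M, fun t ht x => by rw [(huv t ht).1]; exact hM t ht x⟩
  pressure_Lp t ht s hs := by rw [(huv t ht).2]; exact h.pressure_Lp t ht s hs

/-- **The glued velocity is unbounded near a singular time.** If `w` is a Kato solution on `[0,T*)`
with a singular point `(T*, x₀)` (`L^∞` norm infinite on every backward parabolic cylinder), then the
glued classical velocity `t ↦ U((t+T*)/2)(t)` — which agrees with `w(t)` a.e. for every `0 < t < T*`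
(`IsTaoSolutionOn.ae_eq_of_kato`) — is unbounded on `ℝ³ × (0,T*)`.
[cite: LemarieRieusset2016, Thm. 15.1 (C)] -/
theorem glue_unbounded (hUP : ∀ S ∈ Ioo 0 Ts, IsTaoSolutionOn S ν u₀ (U S) (P S)) (hν : 0 < ν)
    (hTs : 0 < Ts) {w : ℝ → (EuclideanSpace ℝ (Fin 3)) → (EuclideanSpace ℝ (Fin 3))} (hw : IsKatoSolutionOn Ts ν u₀ w)
    (hsing : ∃ x₀ : (EuclideanSpace ℝ (Fin 3)), ∀ r : ℝ, 0 < r → r ^ 2 < Ts →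
      eLpNorm (uncurry w) ⊤ (volume.restrict (parabolicCylinder r ((Ts : ℝ), x₀))) = ⊤) :
    ∀ M : ℝ, ∃ t ∈ Ioo 0 Ts, ∃ x, M < ‖U ((t + Ts) / 2) t x‖ := by
  by_contra hcon
  push Not at hcon
  obtain ⟨M, hM⟩ := hcon
  set v : ℝ → (EuclideanSpace ℝ (Fin 3)) → (EuclideanSpace ℝ (Fin 3)) := fun t => U ((t + Ts) / 2) t with hv
  -- `v t = w t` a.e., `0 < t < T*`
  have hvw : ∀ t ∈ Ioo 0 Ts, v t =ᵐ[volume] w t := by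
    intro t ht
    have hS : (t + Ts) / 2 ∈ Ioo 0 Ts := ⟨by linarith [ht.1], by linarith [ht.2]⟩
    have htS : t < (t + Ts) / 2 := by linarith [ht.2]
    exact (hUP _ hS).ae_eq_of_kato hν (hw.mild.mono (Ico_subset_Ico_right hS.2.le))
      (hw.continuousInLpOn.mono (Ico_subset_Ico_right hS.2.le))
      (hw.aestronglyMeasurable.mono_measure (Measure.restrict_mono
        (prod_mono (Ioo_subset_Ioo_right hS.2.le) Subset.rfl) le_rfl)) t ⟨ht.1.le, htS⟩
  -- measurability of the glued velocity on the strip: countable exhaustion by slabs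
  have hvm : AEStronglyMeasurable (uncurry v) (volume.restrict (Ioo 0 Ts ×ˢ univ)) := by
    set Tn : ℕ → ℝ := fun n => Ts - Ts / ((n : ℝ) + 2) with hTn_def
    have hTn : ∀ n, Tn n ∈ Ioo 0 Ts := fun n => by
      have h1 : Ts / ((n : ℝ) + 2) < Ts := by
        rw [div_lt_iff₀ (by positivity)]; nlinarith
      have h2 : 0 < Ts / ((n : ℝ) + 2) := by positivity
      exact ⟨by rw [hTn_def]; linarith, by rw [hTn_def]; linarith⟩
    have hcover : (Ioo 0 Ts ×ˢ (univ : Set (EuclideanSpace ℝ (Fin 3)))) ⊆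
        ⋃ n : ℕ, (Ioo 0 (Tn n) ×ˢ (univ : Set (EuclideanSpace ℝ (Fin 3)))) := by
      rintro ⟨t, x⟩ ⟨ht, -⟩
      obtain ⟨n, hn⟩ := exists_nat_gt (Ts / (Ts - t))
      have hpos : 0 < Ts - t := by linarith [ht.2]
      have hlt : t < Tn n := by
        have h1 : Ts / ((n : ℝ) + 2) < Ts - t := by
          rw [div_lt_iff₀ (by positivity)]
          have := (div_lt_iff₀ hpos).1 hn
          nlinarith
        rw [hTn_def]; linarith
      exact mem_iUnion.2 ⟨n, ⟨ht.1, hlt⟩, mem_univ _⟩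
    refine (aestronglyMeasurable_iUnion_iff.2 fun n => ?_).mono_set hcover
    have hT'' : (Tn n + Ts) / 2 ∈ Ioo 0 Ts := ⟨by linarith [(hTn n).1], by linarith [(hTn n).2]⟩
    have hle : Tn n ≤ (Tn n + Ts) / 2 := by linarith [(hTn n).2]
    refine ((hUP _ hT'').aestronglyMeasurable_uncurry.mono_set
      (prod_mono (Ioo_subset_Ioo_right hle) Subset.rfl)).congr ?_
    filter_upwards [ae_restrict_mem (measurableSet_Ioo.prod MeasurableSet.univ)] with z hz
    obtain ⟨t, x⟩ := z
    obtain ⟨ht, -⟩ := hz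
    simp only [uncurry_apply_pair, hv]
    exact (congrFun (glue_slab hUP hν (hTn n) t ⟨ht.1.le, ht.2.le⟩).1 x).symm
  have hae : uncurry v =ᵐ[volume.restrict (Ioo 0 Ts ×ˢ (univ : Set (EuclideanSpace ℝ (Fin 3))))] uncurry w :=
    ae_restrict_prod_of_forall_ae_eq hvw hvm hw.aestronglyMeasurable
  obtain ⟨x₁, hx₁⟩ := hsing
  have hall : ∀ r : ℝ, 0 < r →
      eLpNorm (uncurry w) ⊤ (volume.restrict (parabolicCylinder r ((Ts : ℝ), x₁))) = ⊤ :=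
    fun r hr => eLpNorm_top_parabolicCylinder_eq_top_of_small hTs hx₁ hr
  -- a small cylinder inside the strip `t > 0`
  set r : ℝ := min 1 (Real.sqrt (Ts / 2)) with hr_def
  have hr0 : 0 < r := lt_min one_pos (Real.sqrt_pos.2 (by positivity))
  have hr2 : r ^ 2 ≤ Ts / 2 := by
    calc r ^ 2 ≤ Real.sqrt (Ts / 2) ^ 2 := pow_le_pow_left₀ hr0.le (min_le_right _ _) 2
      _ = Ts / 2 := Real.sq_sqrt (by positivity)
  have hvtop : eLpNorm (uncurry v) ⊤ (volume.restrict (parabolicCylinder r ((Ts : ℝ), x₁))) = ⊤ :=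
    eLpNorm_parabolicCylinder_eq_top_of_ae_eq hTs hae x₁ hall hr0
  have hvlt : eLpNorm (uncurry v) ⊤ (volume.restrict (parabolicCylinder r ((Ts : ℝ), x₁))) < ⊤ := by
    rw [eLpNorm_exponent_top]
    refine eLpNormEssSup_lt_top_of_ae_bound (C := M) ?_
    filter_upwards [ae_restrict_mem (isOpen_parabolicCylinder r ((Ts : ℝ), x₁)).measurableSet]
      with z hz
    obtain ⟨s, y⟩ := z
    rw [mem_parabolicCylinder] at hz
    exact hM s ⟨by linarith [hz.1.1, hr2], hz.1.2⟩ y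
  exact hvlt.ne hvtop

end Glue


end Summit.NavierStokesRegularity.NavierStokesRegularity.Theorems.Xu2024

end
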